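import Literature.Analysis.ODE.FlowDomain
import Literature.Analysis.ODE.GlobalExistence
import Mathlib.Analysis.Calculus.ContDiff.RCLike
import Mathlib.Geometry.Manifold.Diffeomorph
import HarnessLib

/-!
# Global flows of bounded Lipschitz vector fields; compactly supported time-dependent fields

Trunk: analysis / ODE. Sequel to `Literature/Analysis/ODE/GlobalExistence.lean` (global
existence from a priori bounds), `SmoothDependence.lean` and `FlowDomain.lean` (the flow of a
`C^n` field is `C^n` on its domain; uniqueness; flow property). Everything here is **proved**;
no named facts are introduced.

* `Literature.Analysis.ODE.exists_solution_real_of_lipschitz_of_bound` — a globally Lipschitz, bounded vector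
  field `f` on a Banach space has, through every point, an integral curve defined on all of `ℝ`
  (forward and backward global existence, Teschl (2012), Cor. 2.16 / Lang (1995), IV §1, glued
  at `t = 0`);
* `Literature.ODE.globalFlow hK hL : F → ℝ → F` — the resulting **global flow** with its API:
  `globalFlow_zero`, `hasDerivAt_globalFlow`, uniqueness `eqOn_globalFlow`, the group law
  `globalFlow_add` (Lang (1995), IV §1, Thm. 1.15), and joint smoothness `contDiff_globalFlow`
  for `C^n` fields, `n ≥ 1` (Lang, Thm. 1.16, through `contDiffOn_flow_of_hasDerivAt`);
* `Literature.ODE.tdFlow hX hsupp hn t₀ t : E → E` — the **time-dependent flow** ("evolution operator",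
  position at time `t` of the solution of `u' = X(t, u)` passing through `x` at time `t₀`) of a
  `C^n`, `n ≥ 1`, time-dependent vector field `X : ℝ × E → E` **with compact support** (in
  `ℝ × E`), obtained from the global flow of the suspended autonomous field `(1, X)` on `ℝ × E`
  (Lang (1995), IV §1, p. 61; Hirsch, *Differential Topology* (1976), Ch. 8, §1, Thms. 1.1–1.2:
  "a time-dependent vector field with compact support generates a one-parameter family of
  diffeomorphisms"): `tdFlow_self`, `hasDerivAt_tdFlow`, `contDiff_tdFlow` (jointly in
  `(t₀, t, x)`), the Chapman–Kolmogorov law `tdFlow_trans`, uniqueness `tdFlow_eq_of_hasDerivAt`,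
  `tdFlow_eq_self_of_forall_eq_zero` (points where the field vanishes for all times are fixed),
  `exists_forall_le_norm_tdFlow_eq_self` (the flow is the identity off a ball), and the
  diffeomorphisms `Literature.ODE.tdFlowDiffeomorph hX hsupp hn t₀ t : E ≃ₘ^n⟮𝓘(ℝ, E), 𝓘(ℝ, E)⟯ E`.

This is the ODE input of the isotopy extension theorem (Hirsch (1976), Ch. 8, Thm. 1.3) used in
`Literature/Topology/FourManifolds/` for the uniqueness of tubular neighbourhoods.

## References

* S. Lang, *Differential and Riemannian Manifolds*, GTM 160 (1995), Ch. IV §1 (Thms. 1.15, 1.16;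
  time-dependent fields p. 61). [Lang1995]
* G. Teschl, *Ordinary Differential Equations and Dynamical Systems*, GSM 140 (2012), Cor. 2.16.
  [Teschl2012]
* M. W. Hirsch, *Differential Topology*, GTM 33 (1976), Ch. 8 §1, Thms. 1.1–1.2. [Hirsch1976]

## Design notes

* `globalFlow` and `tdFlow` are definitions by choice from the existence theorems; all their
  properties are theorems (uniqueness of integral curves makes the choice irrelevant).
* Hypotheses are kept in the simplest form used downstream: global Lipschitz constant and global
  bound for `globalFlow` (both automatic for the suspension of a compactly supported `C¹` field).
-/

noncomputable section

open Set Metric Filter Topology Function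
open scoped ContDiff NNReal Manifold

namespace Literature.Analysis.ODE

universe u

/-! ### Integral curves on all of `ℝ` for bounded Lipschitz fields -/

section Global

variable {F : Type u} [NormedAddCommGroup F] [NormedSpace ℝ F]

/-- A priori bound: a solution of `α' = v(t, α)` on `[0, s]` for a field bounded by `L` moves at
most `L t` in time `t`. [folklore] -/
theorem norm_sub_le_of_solution_of_bound {v : ℝ → F → F} {L : ℝ} (hL : ∀ t x, ‖v t x‖ ≤ L)
    {s : ℝ} {α : ℝ → F} (hα : ∀ t ∈ Icc 0 s, HasDerivWithinAt α (v t (α t)) (Icc 0 s) t)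
    {t : ℝ} (ht : t ∈ Icc 0 s) : ‖α t - α 0‖ ≤ L * t := by
  have h := (convex_Icc 0 s).norm_image_sub_le_of_norm_hasDerivWithin_le hα
    (fun u _ => hL u (α u)) (left_mem_Icc.2 (ht.1.trans ht.2)) ht
  simpa [Real.norm_eq_abs, abs_of_nonneg ht.1] using h

variable [CompleteSpace F]

/-- **Forward global existence** for a (time-independent) globally Lipschitz and bounded field:
a solution on `[0, ∞)` through every point (`exists_solution_Ici_of_apriori_bound` with the
trivial a priori bound `‖α t‖ ≤ ‖q₀‖ + L T`). [cite: Teschl2012, Cor. 2.16] -/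
theorem exists_solution_Ici_of_lipschitz_of_bound {g : F → F} {K : ℝ≥0} (hK : LipschitzWith K g)
    {L : ℝ} (hL : ∀ q, ‖g q‖ ≤ L) (q₀ : F) :
    ∃ α : ℝ → F, α 0 = q₀ ∧ (∀ t, 0 ≤ t → HasDerivWithinAt α (g (α t)) (Ici 0) t) ∧
      ∀ t, 0 < t → HasDerivAt α (g (α t)) t := by
  have hL0 : 0 ≤ L := (norm_nonneg _).trans (hL q₀)
  obtain ⟨α, h0, -, hIci, hpos⟩ := exists_solution_Ici_of_apriori_bound (v := fun _ => g)
    (x₀ := q₀) (fun _ _ => ⟨K, fun _ _ => hK.lipschitzOnWith⟩) (fun _ => continuousOn_const)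
    (fun T hT => ⟨‖q₀‖ + L * T, le_add_of_nonneg_right (mul_nonneg hL0 hT), fun s hs β hβ0 hβ t ht => by
      have h1 : ‖β t - β 0‖ ≤ L * t :=
        norm_sub_le_of_solution_of_bound (v := fun _ => g) (fun _ x => hL x) hβ ht
      calc ‖β t‖ = ‖(β t - β 0) + β 0‖ := by rw [sub_add_cancel]
        _ ≤ ‖β t - β 0‖ + ‖β 0‖ := norm_add_le _ _
        _ ≤ L * t + ‖q₀‖ := add_le_add h1 (by rw [hβ0])
        _ ≤ ‖q₀‖ + L * T := by nlinarith [ht.2, hs.2]⟩)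
  exact ⟨α, h0, hIci, hpos⟩

/-- **Global existence on `ℝ`** for a globally Lipschitz, bounded, time-independent vector field
on a Banach space: through every point passes an integral curve defined for all times (forward
solution of `g` and forward solution of `-g`, glued at `t = 0`). [cite: Teschl2012, Cor. 2.16] -/
theorem exists_solution_real_of_lipschitz_of_bound {g : F → F} {K : ℝ≥0} (hK : LipschitzWith K g)
    {L : ℝ} (hL : ∀ q, ‖g q‖ ≤ L) (q₀ : F) :
    ∃ α : ℝ → F, α 0 = q₀ ∧ ∀ t, HasDerivAt α (g (α t)) t := by
  obtain ⟨αp, h0p, hIcip, hposp⟩ := exists_solution_Ici_of_lipschitz_of_bound hK hL q₀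
  have hKn : LipschitzWith K fun q => -g q := by
    refine LipschitzWith.of_dist_le_mul fun x y => ?_
    rw [dist_neg_neg]
    exact hK.dist_le_mul x y
  obtain ⟨αm, h0m, hIcim, hposm⟩ := exists_solution_Ici_of_lipschitz_of_bound hKn
    (fun q => by rw [norm_neg]; exact hL q) q₀
  refine ⟨fun t => if 0 ≤ t then αp t else (αm ∘ Neg.neg) t, by simp [h0p], fun t => ?_⟩
  show HasDerivAt _ (g (if 0 ≤ t then αp t else (αm ∘ Neg.neg) t)) t
  rcases lt_trichotomy t 0 with ht | rfl | ht
  · -- `t < 0`: the curve is `αm (-t)` near `t`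
    have hev : (fun s => if 0 ≤ s then αp s else (αm ∘ Neg.neg) s) =ᶠ[𝓝 t] (αm ∘ Neg.neg) := by
      filter_upwards [Iio_mem_nhds ht] with s hs
      rw [if_neg (not_le.2 hs)]
    have hd : HasDerivAt (αm ∘ Neg.neg) (g ((αm ∘ Neg.neg) t)) t := by
      have h1 := hposm (-t) (by linarith)
      have h2 := h1.scomp t (hasDerivAt_neg (x := t))
      rwa [neg_smul, one_smul, neg_neg] at h2
    rw [if_neg (not_le.2 ht)]
    exact hd.congr_of_eventuallyEq hev
  · -- `t = 0`: the one-sided derivatives agree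
    rw [if_pos le_rfl, h0p]
    have hr : HasDerivWithinAt (fun s => if 0 ≤ s then αp s else (αm ∘ Neg.neg) s) (g q₀)
        (Ici 0) 0 := by
      have h1 := hIcip 0 le_rfl
      rw [h0p] at h1
      exact h1.congr (fun s hs => by rw [if_pos (mem_Ici.1 hs)]) (by simp [h0p])
    have hl : HasDerivWithinAt (fun s => if 0 ≤ s then αp s else (αm ∘ Neg.neg) s) (g q₀)
        (Iic 0) 0 := by
      have h1 := hIcim 0 le_rfl
      rw [h0m] at h1
      have h2 : HasDerivWithinAt (αm ∘ Neg.neg) ((-1 : ℝ) • -g q₀) (Iic 0) 0 :=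
        h1.scomp_of_eq (0 : ℝ) (hasDerivWithinAt_neg (x := (0 : ℝ)) (s := Iic 0))
          (fun s hs => mem_Ici.2 (neg_nonneg.2 (mem_Iic.1 hs))) neg_zero.symm
      rw [neg_smul, one_smul, neg_neg] at h2
      refine h2.congr (fun s hs => ?_) (by simp [h0p, h0m])
      rcases (mem_Iic.1 hs).lt_or_eq with hs' | rfl
      · rw [if_neg (not_le.2 hs')]
      · simp [h0p, h0m]
    have := hl.union hr
    rwa [Iic_union_Ici, hasDerivWithinAt_univ] at this
  · -- `t > 0`
    have hev : (fun s => if 0 ≤ s then αp s else (αm ∘ Neg.neg) s) =ᶠ[𝓝 t] αp := by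
      filter_upwards [Ioi_mem_nhds ht] with s hs
      rw [if_pos (le_of_lt hs)]
    rw [if_pos ht.le]
    exact (hposp t ht).congr_of_eventuallyEq hev

/-! ### The global flow -/

variable {g : F → F} {K : ℝ≥0} {L : ℝ}

/-- The **global flow** `Ψ q t` of a globally Lipschitz bounded vector field `g` (the integral
curve through `q` at time `0`, evaluated at time `t`; a definition by choice, characterised by
`globalFlow_zero`, `hasDerivAt_globalFlow` and uniqueness `eqOn_globalFlow`).
Lang (1995), Ch. IV §1. [cite: Lang1995, Ch. IV §1, Thm. 1.16] -/
def globalFlow (hK : LipschitzWith K g) (hL : ∀ q, ‖g q‖ ≤ L) (q : F) : ℝ → F :=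
  (exists_solution_real_of_lipschitz_of_bound hK hL q).choose

/-- The global flow starts at `q`. [folklore] -/
@[simp]
theorem globalFlow_zero (hK : LipschitzWith K g) (hL : ∀ q, ‖g q‖ ≤ L) (q : F) :
    globalFlow hK hL q 0 = q :=
  (exists_solution_real_of_lipschitz_of_bound hK hL q).choose_spec.1

/-- The global flow consists of integral curves. [folklore] -/
theorem hasDerivAt_globalFlow (hK : LipschitzWith K g) (hL : ∀ q, ‖g q‖ ≤ L) (q : F) (t : ℝ) :
    HasDerivAt (globalFlow hK hL q) (g (globalFlow hK hL q t)) t :=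
  (exists_solution_real_of_lipschitz_of_bound hK hL q).choose_spec.2 t

/-- The curves of the global flow are continuous. [folklore] -/
theorem continuous_globalFlow (hK : LipschitzWith K g) (hL : ∀ q, ‖g q‖ ≤ L) (q : F) :
    Continuous (globalFlow hK hL q) :=
  continuous_iff_continuousAt.2 fun t => (hasDerivAt_globalFlow hK hL q t).continuousAt

/-- **Uniqueness**: an integral curve on an open interval containing `0` is the flow curve of
its value at `0` (Lang (1995), IV §1, Thm. 1.3). [cite: Lang1995, Ch. IV §1, Thm. 1.3] -/
theorem eqOn_globalFlow (hK : LipschitzWith K g) (hL : ∀ q, ‖g q‖ ≤ L) {γ : ℝ → F} {a b : ℝ}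
    (h0 : (0 : ℝ) ∈ Ioo a b) (hγ : ∀ t ∈ Ioo a b, HasDerivAt γ (g (γ t)) t) :
    EqOn γ (globalFlow hK hL (γ 0)) (Ioo a b) :=
  eqOn_Ioo_of_hasDerivAt isOpen_univ (hK.locallyLipschitz.locallyLipschitzOn) h0 hγ
    (fun _ _ => mem_univ _) (fun t _ => hasDerivAt_globalFlow hK hL _ t) (by simp)

/-- **The group law** `Ψ q (s + t) = Ψ (Ψ q s) t` of the global flow (Lang (1995), IV §1,
Thm. 1.15). [cite: Lang1995, Ch. IV §1, Thm. 1.15] -/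
theorem globalFlow_add (hK : LipschitzWith K g) (hL : ∀ q, ‖g q‖ ≤ L) (q : F) (s t : ℝ) :
    globalFlow hK hL q (s + t) = globalFlow hK hL (globalFlow hK hL q s) t := by
  set T : ℝ := |s| + |t| + 1 with hT
  have hs : s ∈ Ioo (-T) T := by constructor <;> cases abs_cases s <;> linarith [abs_nonneg t]
  have ht : t ∈ Ioo (-T) T := by constructor <;> cases abs_cases t <;> linarith [abs_nonneg s]
  have hst : s + t ∈ Ioo (-T) T := by
    constructor <;> cases abs_cases s <;> cases abs_cases t <;> linarith
  exact flow_add_of_hasDerivAt (f := g) (U := univ) (V := univ) isOpen_univ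
    hK.locallyLipschitz.locallyLipschitzOn (Φ := globalFlow hK hL) (T := T)
    (fun q _ => globalFlow_zero hK hL q) (fun q _ t _ => hasDerivAt_globalFlow hK hL q t)
    (fun _ _ _ _ => mem_univ _) (mem_univ q) hs (mem_univ _) ht hst

/-- The time-`t` and time-`(-t)` maps of the global flow are inverse to each other. [folklore] -/
theorem globalFlow_neg_globalFlow (hK : LipschitzWith K g) (hL : ∀ q, ‖g q‖ ≤ L) (q : F)
    (t : ℝ) : globalFlow hK hL (globalFlow hK hL q t) (-t) = q := by
  rw [← globalFlow_add, add_neg_cancel, globalFlow_zero]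

/-- **Smoothness of the global flow**, jointly in the initial point and time, for a `C^n` field,
`n ≥ 1` (Lang (1995), IV §1, Thm. 1.16, via `contDiffOn_flow_of_hasDerivAt`).
[cite: Lang1995, Ch. IV §1, Thm. 1.16] -/
theorem contDiff_globalFlow {n : ℕ∞} (hg : ContDiff ℝ n g) (hn : 1 ≤ n) (hK : LipschitzWith K g)
    (hL : ∀ q, ‖g q‖ ≤ L) : ContDiff ℝ n fun p : F × ℝ => globalFlow hK hL p.1 p.2 := by
  refine contDiff_iff_contDiffAt.2 fun p => ?_
  set T : ℝ := |p.2| + 1 with hT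
  have hmem : p ∈ (univ : Set F) ×ˢ Ioo (-T) T :=
    ⟨mem_univ _, by constructor <;> cases abs_cases p.2 <;> linarith⟩
  have h := contDiffOn_flow_of_hasDerivAt (f := g) (U := univ) isOpen_univ hg.contDiffOn hn
    (Φ := globalFlow hK hL) (V := univ) isOpen_univ (T := T)
    (fun q _ => globalFlow_zero hK hL q) (fun q _ t _ => hasDerivAt_globalFlow hK hL q t)
    (fun _ _ _ _ => mem_univ _)
  exact h.contDiffAt ((isOpen_univ.prod isOpen_Ioo).mem_nhds hmem)

/-- A point where the field vanishes is fixed by the flow. [folklore] -/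
theorem globalFlow_eq_self_of_eq_zero (hK : LipschitzWith K g) (hL : ∀ q, ‖g q‖ ≤ L) {q : F}
    (hq : g q = 0) (t : ℝ) : globalFlow hK hL q t = q := by
  have ht : t ∈ Ioo (-(|t| + 1)) (|t| + 1) := by
    constructor <;> cases abs_cases t <;> linarith
  have h := eqOn_globalFlow hK hL (γ := fun _ => q) (a := -(|t| + 1)) (b := |t| + 1)
    ⟨by linarith [abs_nonneg t], by linarith [abs_nonneg t]⟩
    (fun s _ => by simpa [hq] using hasDerivAt_const s q)
  exact (h ht).symm

end Global

/-! ### Compactly supported time-dependent fields: the suspension -/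

section TimeDependent

variable {E : Type u} [NormedAddCommGroup E] [NormedSpace ℝ E]

/-- The **suspension** `(t, x) ↦ (1, X(t, x))` of a time-dependent vector field: the autonomous
field on `ℝ × E` whose integral curves are the graphs of the solutions of `u' = X(t, u)`
(Lang (1995), IV §1, p. 61). [cite: Lang1995, Ch. IV §1, p. 61] -/
def suspension (X : ℝ × E → E) (q : ℝ × E) : ℝ × E := (1, X q)

omit [NormedAddCommGroup E] [NormedSpace ℝ E] in
/-- The suspension, unfolded. [folklore] -/
@[simp]
theorem suspension_apply (X : ℝ × E → E) (q : ℝ × E) : suspension X q = (1, X q) := rfl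

/-- The suspension of a `C^n` field is `C^n`. [folklore] -/
theorem contDiff_suspension {n : ℕ∞} {X : ℝ × E → E} (hX : ContDiff ℝ n X) :
    ContDiff ℝ n (suspension X) :=
  contDiff_const.prodMk hX

omit [NormedSpace ℝ E] in
/-- The suspension of a Lipschitz field is Lipschitz with the same constant. [folklore] -/
theorem lipschitzWith_suspension {X : ℝ × E → E} {C : ℝ≥0} (hC : LipschitzWith C X) :
    LipschitzWith C (suspension X) := by
  refine LipschitzWith.of_dist_le_mul fun q q' => ?_
  have h := hC.dist_le_mul q q'
  simp only [suspension_apply, Prod.dist_eq, dist_self] at h ⊢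
  rw [max_eq_right dist_nonneg]
  exact h

omit [NormedSpace ℝ E] in
/-- The suspension of a field bounded by `B` is bounded by `max 1 B`. [folklore] -/
theorem norm_suspension_le {X : ℝ × E → E} {B : ℝ} (hB : ∀ q, ‖X q‖ ≤ B) (q : ℝ × E) :
    ‖suspension X q‖ ≤ max 1 B := by
  simp only [suspension_apply, Prod.norm_def, norm_one]
  exact max_le_max le_rfl (hB q)

/-- A compactly supported `C^n` time-dependent field, `n ≥ 1`, has a Lipschitz and bounded
suspension. [folklore] -/
theorem exists_lipschitzWith_suspension {n : ℕ∞} {X : ℝ × E → E} (hX : ContDiff ℝ n X)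
    (hsupp : HasCompactSupport X) (hn : 1 ≤ n) :
    ∃ KL : ℝ≥0 × ℝ, LipschitzWith KL.1 (suspension X) ∧ ∀ q, ‖suspension X q‖ ≤ KL.2 := by
  have hn0 : ((n : ℕ∞) : WithTop ℕ∞) ≠ 0 := by
    have : (n : ℕ∞) ≠ 0 := Order.one_le_iff_ne_zero.1 hn
    exact_mod_cast this
  obtain ⟨C, hC⟩ := hX.lipschitzWith_of_hasCompactSupport hsupp hn0
  obtain ⟨B, hB⟩ := hsupp.exists_bound_of_continuous hX.continuous
  exact ⟨(C, max 1 B), lipschitzWith_suspension hC, norm_suspension_le hB⟩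

variable [CompleteSpace E] {n : ℕ∞} {X : ℝ × E → E}

/-- The global flow of the suspension of a compactly supported `C^n` field (`n ≥ 1`).
[folklore] -/
def suspensionFlow (hX : ContDiff ℝ n X) (hsupp : HasCompactSupport X) (hn : 1 ≤ n) :
    ℝ × E → ℝ → ℝ × E :=
  globalFlow (exists_lipschitzWith_suspension hX hsupp hn).choose_spec.1
    (exists_lipschitzWith_suspension hX hsupp hn).choose_spec.2

/-- The suspension flow starts at the given point. [folklore] -/
theorem suspensionFlow_zero (hX : ContDiff ℝ n X) (hsupp : HasCompactSupport X) (hn : 1 ≤ n)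
    (q : ℝ × E) : suspensionFlow hX hsupp hn q 0 = q :=
  globalFlow_zero _ _ q

/-- The suspension flow consists of integral curves of the suspension. [folklore] -/
theorem hasDerivAt_suspensionFlow (hX : ContDiff ℝ n X) (hsupp : HasCompactSupport X)
    (hn : 1 ≤ n) (q : ℝ × E) (s : ℝ) :
    HasDerivAt (suspensionFlow hX hsupp hn q) (suspension X (suspensionFlow hX hsupp hn q s)) s :=
  hasDerivAt_globalFlow _ _ q s

/-- Group law of the suspension flow. [folklore] -/
theorem suspensionFlow_add (hX : ContDiff ℝ n X) (hsupp : HasCompactSupport X) (hn : 1 ≤ n)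
    (q : ℝ × E) (s t : ℝ) : suspensionFlow hX hsupp hn q (s + t) =
      suspensionFlow hX hsupp hn (suspensionFlow hX hsupp hn q s) t :=
  globalFlow_add _ _ q s t

/-- Joint smoothness of the suspension flow. [folklore] -/
theorem contDiff_suspensionFlow (hX : ContDiff ℝ n X) (hsupp : HasCompactSupport X)
    (hn : 1 ≤ n) : ContDiff ℝ n fun p : (ℝ × E) × ℝ => suspensionFlow hX hsupp hn p.1 p.2 :=
  contDiff_globalFlow (contDiff_suspension hX) hn _ _

/-- Uniqueness of integral curves of the suspension. [folklore] -/
theorem eqOn_suspensionFlow (hX : ContDiff ℝ n X) (hsupp : HasCompactSupport X) (hn : 1 ≤ n)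
    {Γ : ℝ → ℝ × E} {a b : ℝ} (h0 : (0 : ℝ) ∈ Ioo a b)
    (hΓ : ∀ s ∈ Ioo a b, HasDerivAt Γ (suspension X (Γ s)) s) :
    EqOn Γ (suspensionFlow hX hsupp hn (Γ 0)) (Ioo a b) :=
  eqOn_globalFlow _ _ h0 hΓ

/-- The time coordinate moves with unit speed under the suspension flow:
`(Ψ q s).1 = q.1 + s`. [folklore] -/
theorem fst_suspensionFlow (hX : ContDiff ℝ n X) (hsupp : HasCompactSupport X) (hn : 1 ≤ n)
    (q : ℝ × E) (s : ℝ) : (suspensionFlow hX hsupp hn q s).1 = q.1 + s := by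
  -- `σ ↦ (Ψ q σ).1 - σ` has zero derivative, hence is constant
  have h1 : ∀ σ, HasDerivAt (fun σ => (suspensionFlow hX hsupp hn q σ).1 - σ) 0 σ := fun σ => by
    have h : HasDerivAt (fun σ => (suspensionFlow hX hsupp hn q σ).1) 1 σ :=
      (ContinuousLinearMap.fst ℝ ℝ E).hasFDerivAt.comp_hasDerivAt σ
        (hasDerivAt_suspensionFlow hX hsupp hn q σ)
    have h2 := h.sub (hasDerivAt_id σ)
    rw [sub_self] at h2
    exact h2
  have hconst := is_const_of_deriv_eq_zero (fun σ => (h1 σ).differentiableAt)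
    (fun σ => (h1 σ).deriv) s 0
  simp only [sub_zero, suspensionFlow_zero] at hconst
  linarith [hconst]

/-! ### The time-dependent flow -/

/-- The **time-dependent flow** (evolution operator) of a compactly supported `C^n` field
`X : ℝ × E → E`, `n ≥ 1`: `tdFlow hX hsupp hn t₀ t x` is the position at time `t` of the
solution of `u' = X(t, u)` with `u(t₀) = x` (the `E`-component of the suspension flow through
`(t₀, x)` at time `t - t₀`; Lang (1995), IV §1, p. 61; Hirsch (1976), Ch. 8 §1, Thm. 1.1).
[cite: Hirsch1976, Ch. 8 §1, Thm. 1.1] -/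
def tdFlow (hX : ContDiff ℝ n X) (hsupp : HasCompactSupport X) (hn : 1 ≤ n) (t₀ t : ℝ)
    (x : E) : E :=
  (suspensionFlow hX hsupp hn (t₀, x) (t - t₀)).2

/-- The suspension flow through `(t₀, x)` at time `t - t₀` is `(t, tdFlow t₀ t x)`. [folklore] -/
theorem suspensionFlow_eq (hX : ContDiff ℝ n X) (hsupp : HasCompactSupport X) (hn : 1 ≤ n)
    (t₀ t : ℝ) (x : E) :
    suspensionFlow hX hsupp hn (t₀, x) (t - t₀) = (t, tdFlow hX hsupp hn t₀ t x) := by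
  ext
  · rw [fst_suspensionFlow]; ring
  · rfl

/-- The solution through `x` at time `t₀` is at `x` at time `t₀`. [folklore] -/
@[simp]
theorem tdFlow_self (hX : ContDiff ℝ n X) (hsupp : HasCompactSupport X) (hn : 1 ≤ n) (t₀ : ℝ)
    (x : E) : tdFlow hX hsupp hn t₀ t₀ x = x := by
  simp [tdFlow, suspensionFlow_zero]

/-- `t ↦ tdFlow t₀ t x` solves `u' = X(t, u)`. [folklore] -/
theorem hasDerivAt_tdFlow (hX : ContDiff ℝ n X) (hsupp : HasCompactSupport X) (hn : 1 ≤ n)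
    (t₀ : ℝ) (x : E) (t : ℝ) :
    HasDerivAt (fun s => tdFlow hX hsupp hn t₀ s x) (X (t, tdFlow hX hsupp hn t₀ t x)) t := by
  have h : HasDerivAt (fun s => (suspensionFlow hX hsupp hn (t₀, x) s).2)
      (X (suspensionFlow hX hsupp hn (t₀, x) (t - t₀))) (t - t₀) :=
    (ContinuousLinearMap.snd ℝ ℝ E).hasFDerivAt.comp_hasDerivAt (t - t₀)
      (hasDerivAt_suspensionFlow hX hsupp hn (t₀, x) (t - t₀))
  rw [suspensionFlow_eq] at h
  exact h.comp_sub_const t t₀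

/-- **Joint smoothness** of the time-dependent flow in `(t₀, t, x)`. [cite: Lang1995, Ch. IV §1, Thm. 1.16] -/
theorem contDiff_tdFlow (hX : ContDiff ℝ n X) (hsupp : HasCompactSupport X) (hn : 1 ≤ n) :
    ContDiff ℝ n fun p : ℝ × ℝ × E => tdFlow hX hsupp hn p.1 p.2.1 p.2.2 := by
  have h := contDiff_suspensionFlow hX hsupp hn
  have hinner : ContDiff ℝ n fun p : ℝ × ℝ × E => (((p.1, p.2.2) : ℝ × E), p.2.1 - p.1) :=
    (contDiff_fst.prodMk (contDiff_snd.comp contDiff_snd)).prodMk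
      ((contDiff_fst.comp contDiff_snd).sub contDiff_fst)
  exact (h.comp hinner).snd

/-- Smoothness of each evolution map `x ↦ tdFlow t₀ t x`. [folklore] -/
theorem contDiff_tdFlow_apply (hX : ContDiff ℝ n X) (hsupp : HasCompactSupport X) (hn : 1 ≤ n)
    (t₀ t : ℝ) : ContDiff ℝ n (tdFlow hX hsupp hn t₀ t) :=
  (contDiff_tdFlow hX hsupp hn).comp (contDiff_const.prodMk (contDiff_const.prodMk contDiff_id))

/-- **Chapman–Kolmogorov law**: evolving from `t₀` to `t₁` and then from `t₁` to `t₂` is evolving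
from `t₀` to `t₂` (the group law of the suspension flow). [folklore] -/
theorem tdFlow_trans (hX : ContDiff ℝ n X) (hsupp : HasCompactSupport X) (hn : 1 ≤ n)
    (t₀ t₁ t₂ : ℝ) (x : E) :
    tdFlow hX hsupp hn t₁ t₂ (tdFlow hX hsupp hn t₀ t₁ x) = tdFlow hX hsupp hn t₀ t₂ x := by
  have h := suspensionFlow_add hX hsupp hn (t₀, x) (t₁ - t₀) (t₂ - t₁)
  rw [suspensionFlow_eq hX hsupp hn t₀ t₁ x, show t₁ - t₀ + (t₂ - t₁) = t₂ - t₀ by ring,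
    suspensionFlow_eq, suspensionFlow_eq] at h
  exact (Prod.ext_iff.1 h).2.symm

/-- Evolving from `t₀` to `t₁` and back is the identity. [folklore] -/
@[simp]
theorem tdFlow_tdFlow_symm (hX : ContDiff ℝ n X) (hsupp : HasCompactSupport X) (hn : 1 ≤ n)
    (t₀ t₁ : ℝ) (x : E) :
    tdFlow hX hsupp hn t₁ t₀ (tdFlow hX hsupp hn t₀ t₁ x) = x := by
  rw [tdFlow_trans, tdFlow_self]

/-- **Uniqueness**: a solution of `u' = X(t, u)` on an open interval containing `t₀` is
transported by the flow: `tdFlow t₀ t (γ t₀) = γ t`. [cite: Lang1995, Ch. IV §1, Thm. 1.3] -/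
theorem tdFlow_eq_of_hasDerivAt (hX : ContDiff ℝ n X) (hsupp : HasCompactSupport X)
    (hn : 1 ≤ n) {γ : ℝ → E} {a b t₀ : ℝ} (ht₀ : t₀ ∈ Ioo a b)
    (hγ : ∀ t ∈ Ioo a b, HasDerivAt γ (X (t, γ t)) t) {t : ℝ} (ht : t ∈ Ioo a b) :
    tdFlow hX hsupp hn t₀ t (γ t₀) = γ t := by
  -- the graph `s ↦ (t₀ + s, γ (t₀ + s))` is an integral curve of the suspension
  have hΓ : ∀ s ∈ Ioo (a - t₀) (b - t₀),
      HasDerivAt (fun s => ((t₀ + s, γ (t₀ + s)) : ℝ × E))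
        (suspension X (t₀ + s, γ (t₀ + s))) s := by
    intro s hs
    have hs' : t₀ + s ∈ Ioo a b := ⟨by linarith [hs.1], by linarith [hs.2]⟩
    have h1 : HasDerivAt (fun s => t₀ + s) 1 s := by simpa using (hasDerivAt_id s).const_add t₀
    have h2 : HasDerivAt (fun s => γ (t₀ + s)) (X (t₀ + s, γ (t₀ + s))) s := by
      simpa using (hγ _ hs').comp_const_add t₀ s
    exact h1.prodMk h2
  have key := eqOn_suspensionFlow hX hsupp hn (a := a - t₀) (b := b - t₀)
    ⟨by linarith [ht₀.1], by linarith [ht₀.2]⟩ hΓ (x := t - t₀) ⟨by linarith [ht.1], by linarith [ht.2]⟩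
  simp only [add_zero] at key
  rw [suspensionFlow_eq] at key
  have := (Prod.ext_iff.1 key).2
  simpa using this.symm

/-- A point at which the field vanishes at all times is fixed by the flow. [folklore] -/
theorem tdFlow_eq_self_of_forall_eq_zero (hX : ContDiff ℝ n X) (hsupp : HasCompactSupport X)
    (hn : 1 ≤ n) {x : E} (hx : ∀ t, X (t, x) = 0) (t₀ t : ℝ) :
    tdFlow hX hsupp hn t₀ t x = x := by
  set T : ℝ := |t₀| + |t| + 1
  have h := tdFlow_eq_of_hasDerivAt hX hsupp hn (γ := fun _ => x) (a := -T) (b := T) (t₀ := t₀)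
    (by constructor <;> cases abs_cases t₀ <;> linarith [abs_nonneg t])
    (fun s _ => by simpa [hx] using hasDerivAt_const s x) (t := t)
    (by constructor <;> cases abs_cases t <;> linarith [abs_nonneg t₀])
  exact h

/-- **The flow of a compactly supported field is the identity off a ball.** [cite: Hirsch1976, Ch. 8 §1, Thm. 1.1] -/
theorem exists_forall_le_norm_tdFlow_eq_self (hX : ContDiff ℝ n X) (hsupp : HasCompactSupport X)
    (hn : 1 ≤ n) : ∃ R : ℝ, ∀ x : E, R ≤ ‖x‖ → ∀ t₀ t, tdFlow hX hsupp hn t₀ t x = x := by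
  obtain ⟨R, hR⟩ := (hsupp.isCompact.isBounded).subset_closedBall 0 |>.imp fun R h => h
  refine ⟨R + 1, fun x hx t₀ t => tdFlow_eq_self_of_forall_eq_zero hX hsupp hn (fun s => ?_) t₀ t⟩
  apply image_eq_zero_of_notMem_tsupport
  intro hmem
  have h1 := hR hmem
  rw [mem_closedBall, dist_zero_right, Prod.norm_def] at h1
  have : ‖x‖ ≤ R := (le_max_right _ _).trans h1
  linarith

/-- **The evolution maps are diffeomorphisms** `E ≅ E` (inverse: evolving back; Hirsch (1976),
Ch. 8 §1, Thms. 1.1–1.2: a compactly supported time-dependent vector field generates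
diffeomorphisms). [cite: Hirsch1976, Ch. 8 §1, Thm. 1.1] -/
def tdFlowDiffeomorph (hX : ContDiff ℝ n X) (hsupp : HasCompactSupport X) (hn : 1 ≤ n)
    (t₀ t₁ : ℝ) : Diffeomorph 𝓘(ℝ, E) 𝓘(ℝ, E) E E n where
  toFun := tdFlow hX hsupp hn t₀ t₁
  invFun := tdFlow hX hsupp hn t₁ t₀
  left_inv x := tdFlow_tdFlow_symm hX hsupp hn t₀ t₁ x
  right_inv x := tdFlow_tdFlow_symm hX hsupp hn t₁ t₀ x
  contMDiff_toFun := (contDiff_tdFlow_apply hX hsupp hn t₀ t₁).contMDiff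
  contMDiff_invFun := (contDiff_tdFlow_apply hX hsupp hn t₁ t₀).contMDiff

/-- The evolution diffeomorphism as a function. [folklore] -/
@[simp]
theorem coe_tdFlowDiffeomorph (hX : ContDiff ℝ n X) (hsupp : HasCompactSupport X) (hn : 1 ≤ n)
    (t₀ t₁ : ℝ) : ⇑(tdFlowDiffeomorph hX hsupp hn t₀ t₁) = tdFlow hX hsupp hn t₀ t₁ := rfl

end TimeDependent

end Literature.Analysis.ODE

end
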